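import Summits.ResolutionOfSingularities.ResolutionOfSingularities.Theses.UniversalCells
import Literature.AlgebraicGeometry.Resolution.PrincipalizationToResolution
import Literature.AlgebraicGeometry.Resolution.CanonicalResolutionProofs
import Summits.ResolutionOfSingularities.ResolutionOfSingularities.Theorems.FrobeniusLadderFRationalResolutionAffineSpaceResolution

/-!
# `UniversalCells.ProductDescent` — negative lemmas: shape, irrefutability, degenerate instances

Support (negative-side) lemmas for the crux `stmt-ResolutionOfSingularities-15231`
(`Summit.ResolutionOfSingularities.ResolutionOfSingularities.Theses.UniversalCells.ProductDescent`,
route `UniversalCells`, rank 3), filed by the refuter's crux-attack seat (cdisprove, cycle 1,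
2026-08-17). The crux: for `Y` integral separated of finite type over `𝔽_p = ZMod p`, `s ∈ ℕ`,
`j : W ↪ 𝔸ˢ_Y` an open immersion and `w ∈ W` over `y ∈ Y`,

  UPSTAIRS(w)   := `w` has an open neighbourhood `W' ⊆ W` with a resolution, implies
  DOWNSTAIRS(y) := `y` has an open neighbourhood `U ⊆ Y` with a resolution.

The file declares NO definition (both predicates are written out inline) and does NOT refute
the crux. Findings (all sorry-free):

* §1 SHAPE. DOWNSTAIRS(y) ⇒ UPSTAIRS(w) for every `s, W, j, w` over `y`
  (`upstairs_of_downstairs`: `W' := j⁻¹(𝔸ˢ_U)`, resolved by `𝔸ˢ` of a resolution of `U`,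
  `FRationalResolution.hasResolution_affineSpace` in tree), so the crux is a PURE CONVERSE:
  `ProductDescent ↔ ∀ …, UPSTAIRS(w) ↔ DOWNSTAIRS(y)` (`productDescent_iff_upstairs_iff_downstairs`).
  The upstairs datum carries no weight a refuter can remove: dropping it yields pointwise-local
  resolvability over `𝔽_p` (the antecedent `LocRes` of `LocalToGlobal`), which implies the crux
  (`not_locRes_of_not_productDescent`).
* §2 IRREFUTABILITY. `¬ ProductDescent ↔ ∃ p, Y, s, W, j, w` with UPSTAIRS(w) and NO resolvable
  open neighbourhood of `y` (`not_productDescent_iff`); in particular a refutation refutes the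
  route target `PrimeFieldThesis` and the summit (`not_primeFieldThesis_of_not_productDescent`,
  `not_resolutionOfSingularities_of_not_productDescent`). No small model, degenerate regime or
  computation decides it.
* §3 DEGENERATE INSTANCES HOLD OUTRIGHT (so a counterexample avoids them —
  `not_productDescent_minimalCase`, modulo the vendored fact `CossartPiltant2019`): `s = 0`
  (`downstairs_of_fin_zero`: `𝔸⁰_Y ≅ Y`, no hypothesis on `Y` at all); `y` a regular point, in
  particular the generic point (`downstairs_of_isRegularLocalRing`, `downstairs_genericPoint`:
  the regular locus of a scheme locally of finite type over a field is open, Matsumura Cor. to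
  Thm. 30.5, in tree); `dim Y ≤ 3` (Cossart–Piltant). A counterexample therefore has `s ≥ 1`,
  `dim Y ≥ 4`, `y` a non-generic SINGULAR point with no resolvable neighbourhood — i.e. it is a
  failure of LOCAL resolution in characteristic `p`, open from dimension four.

Hypotheses of the crux not formalised here (prover information, see the crux's `Disproof.lean`):
`IsSeparated f` and `QuasiCompact f` are not load-bearing (the statement is local on `Y`);
`IsIntegral Y` can be weakened to `IsReduced` (components); `LocallyOfFiniteType f` is the only
hypothesis whose removal leaves the summit's scope, and every candidate witness examined
(`Spec 𝔽_p[X]⁺`, one-dimensional local domains with infinite normalisation) makes UPSTAIRS fail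
too (vacuous), because the local ring of `𝔸ˢ_Y` at the generic point of the fibre dominates
`𝒪_{Y,y}`.

## Sources
* Y. Hu, arXiv:2109.02968 (2021), §9 p. 64 (the slice step asserted without proof).
* H. Matsumura, *Commutative Ring Theory*, CUP 1986, Cor. to Thm. 30.5 (openness of `Reg`).
* V. Cossart, O. Piltant, J. Algebra 529 (2019), Thm. 1.1 (dimension `≤ 3`).
-/

noncomputable section

-- single-problem summit: the doubled namespace component `ResolutionOfSingularities` is forced
set_option linter.dupNamespace false

open CategoryTheory CategoryTheory.Limits AlgebraicGeometry Literature.AlgebraicGeometry.Resolution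
open Summit.ResolutionOfSingularities.ResolutionOfSingularities.Theses.UniversalCells
  (ProductDescent PrimeFieldThesis)

namespace Summit.ResolutionOfSingularities.ResolutionOfSingularities.Theorems.ProductDescent.Negative

/-! ## §1 Shape: the upstairs hypothesis is implied by the conclusion -/

/-- **DOWNSTAIRS ⇒ UPSTAIRS.** If `y` has a resolvable open neighbourhood `U` in a locally
Noetherian `Y`, then every point `w` of every open `j : W ↪ 𝔸ˢ_Y` lying over `y` has one in `W`:
`W' := j⁻¹(𝔸ˢ_U)`, and `𝔸ˢ_U` is resolved by the affine space over a resolution of `U`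
(`FRationalResolution.hasResolution_affineSpace`). So the crux's hypothesis is exactly as strong
as its conclusion allows — the crux is the converse implication. [folklore] -/
theorem upstairs_of_downstairs {Y : Scheme.{0}} [IsLocallyNoetherian Y] {y : Y}
    (hy : ∃ U : Y.Opens, y ∈ U ∧ Scheme.HasResolution (U : Scheme.{0}))
    (s : ℕ) (W : Scheme.{0}) (j : W ⟶ AffineSpace (Fin s) Y) [IsOpenImmersion j] (w : W)
    (hw : (CategoryTheory.over (AffineSpace (Fin s) Y) Y).base (j.base w) = y) :
    ∃ W' : W.Opens, w ∈ W' ∧ Scheme.HasResolution (W' : Scheme.{0}) := by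
  obtain ⟨U, hyU, hU⟩ := hy
  -- the open immersion `𝔸ˢ_U ↪ 𝔸ˢ_Y`, base change of `U ↪ Y`
  let m : AffineSpace (Fin s) (U : Scheme.{0}) ⟶ AffineSpace (Fin s) Y :=
    AffineSpace.map (Fin s) U.ι
  haveI hm : IsOpenImmersion m :=
    MorphismProperty.IsStableUnderBaseChange.of_isPullback (P := @IsOpenImmersion)
      (AffineSpace.isPullback_map U.ι).flip inferInstance
  have hmem : j.base w ∈ m.opensRange := by
    obtain ⟨z, hz, -⟩ := Scheme.Pullback.exists_preimage_pullback
      (f := CategoryTheory.over (AffineSpace (Fin s) Y) Y) (g := U.ι) (j.base w) ⟨y, hyU⟩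
      (by rw [hw]; rfl)
    refine ⟨(AffineSpace.isPullback_map U.ι).isoPullback.inv.base z, ?_⟩
    rw [← Scheme.Hom.comp_apply, IsPullback.isoPullback_inv_fst]
    exact hz
  have hres : Scheme.HasResolution ((m.opensRange : (AffineSpace (Fin s) Y).Opens) : Scheme.{0}) :=
    Scheme.HasResolution.of_iso m.isoOpensRange.hom
      (Summit.ResolutionOfSingularities.ResolutionOfSingularities.Theorems.FRationalResolution.hasResolution_affineSpace
        s (U : Scheme.{0}) hU)
  exact ⟨j ⁻¹ᵁ m.opensRange, hmem, Scheme.HasResolution.of_isOpenImmersion (j ∣_ m.opensRange) hres⟩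

/-- **The crux is a pure converse**: `ProductDescent` says precisely that, for every datum
`(p, Y, f, s, W, j, w)` of its hypotheses, UPSTAIRS(w) and DOWNSTAIRS(y) are EQUIVALENT (the
direction DOWNSTAIRS ⇒ UPSTAIRS being `upstairs_of_downstairs`). [folklore] -/
theorem productDescent_iff_upstairs_iff_downstairs :
    ProductDescent ↔ ∀ p : ℕ, p.Prime → ∀ (Y : Scheme.{0}) (f : Y ⟶ Spec (.of (ZMod p))),
      IsSeparated f → LocallyOfFiniteType f → QuasiCompact f → IsIntegral Y →
      ∀ (s : ℕ) (W : Scheme.{0}) (j : W ⟶ AffineSpace (Fin s) Y), IsOpenImmersion j → ∀ w : W,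
        ((∃ W' : W.Opens, w ∈ W' ∧ Scheme.HasResolution (W' : Scheme.{0})) ↔
          ∃ U : Y.Opens, (CategoryTheory.over (AffineSpace (Fin s) Y) Y).base (j.base w) ∈ U ∧
            Scheme.HasResolution (U : Scheme.{0})) := by
  refine ⟨fun h p hp Y f hs hl hq hi s W j hj w =>
      ⟨h p hp Y f hs hl hq hi s W j hj w, fun hy => ?_⟩,
    fun h p hp Y f hs hl hq hi s W j hj w hw => (h p hp Y f hs hl hq hi s W j hj w).mp hw⟩
  haveI : Fact p.Prime := ⟨hp⟩
  haveI := hl; haveI := hj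
  haveI : IsLocallyNoetherian Y := LocallyOfFiniteType.isLocallyNoetherian f
  exact upstairs_of_downstairs hy s W j w rfl

/-- Dropping the upstairs datum altogether leaves pointwise-local resolvability over `𝔽_p`
(the antecedent `LocRes` of the sibling crux `LocalToGlobal`), which IMPLIES the crux: a
refutation of `ProductDescent` refutes `LocRes` at some prime. [folklore] -/
theorem not_locRes_of_not_productDescent (h : ¬ ProductDescent) :
    ¬ ∀ p : ℕ, p.Prime → ∀ (X : Scheme.{0}) (f : X ⟶ Spec (.of (ZMod p))), IsSeparated f →
        LocallyOfFiniteType f → QuasiCompact f → IsIntegral X →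
          ∀ x : X, ∃ U : X.Opens, x ∈ U ∧ Scheme.HasResolution (U : Scheme.{0}) :=
  fun hloc => h fun p hp Y f hs hl hq hi _ _ _ _ _ _ => hloc p hp Y f hs hl hq hi _

/-! ## §2 Irrefutability: a counterexample is a failure of LOCAL resolution over `𝔽_p` -/

/-- The shape of a counterexample to the crux: a prime `p`, an integral separated finite-type
`𝔽_p`-scheme `Y`, an open `j : W ↪ 𝔸ˢ_Y` and a point `w ∈ W` with a resolvable open
neighbourhood whose image `y ∈ Y` has NO resolvable open neighbourhood. [folklore] -/
theorem not_productDescent_iff :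
    ¬ ProductDescent ↔ ∃ p : ℕ, p.Prime ∧ ∃ (Y : Scheme.{0}) (f : Y ⟶ Spec (.of (ZMod p))),
      IsSeparated f ∧ LocallyOfFiniteType f ∧ QuasiCompact f ∧ IsIntegral Y ∧
      ∃ (s : ℕ) (W : Scheme.{0}) (j : W ⟶ AffineSpace (Fin s) Y), IsOpenImmersion j ∧
      ∃ w : W, (∃ W' : W.Opens, w ∈ W' ∧ Scheme.HasResolution (W' : Scheme.{0})) ∧
        ∀ U : Y.Opens, (CategoryTheory.over (AffineSpace (Fin s) Y) Y).base (j.base w) ∈ U →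
          ¬ Scheme.HasResolution (U : Scheme.{0}) := by
  constructor
  · intro h
    by_contra hne
    refine h fun p hp Y f hs hl hq hi s W j hj w hw => ?_
    by_contra hU
    exact hne ⟨p, hp, Y, f, hs, hl, hq, hi, s, W, j, hj, w, hw, fun U hyU hres => hU ⟨U, hyU, hres⟩⟩
  · rintro ⟨p, hp, Y, f, hs, hl, hq, hi, s, W, j, hj, w, hw, hU⟩ h
    obtain ⟨U, hyU, hres⟩ := h p hp Y f hs hl hq hi s W j hj w hw
    exact hU U hyU hres

/-- A refutation of the crux refutes the route target `PrimeFieldThesis` (a resolution of `Y`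
restricts to the open neighbourhood `⊤ ∋ y`): the crux is IRREFUTABLE short of disproving
resolution of singularities over the prime field. [folklore] -/
theorem not_primeFieldThesis_of_not_productDescent (h : ¬ ProductDescent) : ¬ PrimeFieldThesis :=
  fun hT => h fun p hp Y f hs hl hq hi _ _ _ _ _ _ =>
    ⟨⊤, trivial, (hT p hp Y f hs hl hq hi).restrict ⊤⟩

/-- … and hence refutes the summit (whose `𝔽_p`-slice contains `PrimeFieldThesis`: `ZMod p` is a
field of characteristic `p` and integral schemes are reduced). [folklore] -/
theorem not_resolutionOfSingularities_of_not_productDescent (h : ¬ ProductDescent) :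
    ¬ _root_.ResolutionOfSingularities := by
  intro hS
  refine not_primeFieldThesis_of_not_productDescent h fun p hp X f hs hl hq hi => ?_
  haveI : Fact p.Prime := ⟨hp⟩
  haveI := hi
  exact hS p hp (ZMod p) X f hs hl hq inferInstance

/-! ## §3 Degenerate instances hold outright -/

/-- **`s = 0` holds outright, for every scheme `Y` whatsoever**: `𝔸⁰_Y → Y` is an isomorphism,
so a resolvable open `W' ∋ w` of `W ↪ 𝔸⁰_Y` IS a resolvable open neighbourhood of `y`. The
content of the crux starts at `s = 1`. [folklore] -/
theorem downstairs_of_fin_zero (Y : Scheme.{0}) (W : Scheme.{0}) (j : W ⟶ AffineSpace (Fin 0) Y)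
    [IsOpenImmersion j] (w : W)
    (hw : ∃ W' : W.Opens, w ∈ W' ∧ Scheme.HasResolution (W' : Scheme.{0})) :
    ∃ U : Y.Opens, (CategoryTheory.over (AffineSpace (Fin 0) Y) Y).base (j.base w) ∈ U ∧
      Scheme.HasResolution (U : Scheme.{0}) := by
  obtain ⟨W', hw, hres⟩ := hw
  let ι' : (W' : Scheme.{0}) ⟶ Y := W'.ι ≫ j ≫ (CategoryTheory.over (AffineSpace (Fin 0) Y) Y)
  haveI : IsOpenImmersion ι' := inferInstanceAs (IsOpenImmersion (W'.ι ≫ j ≫ _))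
  refine ⟨ι'.opensRange, ⟨⟨w, hw⟩, ?_⟩, Scheme.HasResolution.of_iso ι'.isoOpensRange.hom hres⟩
  simp [ι']

/-- **Regular points hold outright**: over a field the regular locus of a scheme locally of
finite type is open (`isOpen_regularLocus_of_locallyOfFiniteType_field`, Matsumura Cor. to
Thm. 30.5) and regular, hence its own resolution. [cite: Matsumura1987, Cor. to Thm. 30.5] -/
theorem downstairs_of_isRegularLocalRing {p : ℕ} {Y : Scheme.{0}}
    (f : Y ⟶ Spec (.of (ZMod p))) [LocallyOfFiniteType f] [Fact p.Prime] (y : Y)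
    (hy : IsRegularLocalRing (Y.presheaf.stalk y)) :
    ∃ U : Y.Opens, y ∈ U ∧ Scheme.HasResolution (U : Scheme.{0}) := by
  let U : Y.Opens := ⟨Scheme.regularLocus Y, isOpen_regularLocus_of_locallyOfFiniteType_field f⟩
  refine ⟨U, hy, Scheme.IsRegular.hasResolution ?_⟩
  intro x
  have hx : IsRegularLocalRing (Y.presheaf.stalk (U.ι.base x)) := x.2
  exact IsRegularLocalRing.of_ringEquiv (asIso (U.ι.stalkMap x)).commRingCatIsoToRingEquiv

/-- In particular the generic point of an integral `Y` locally of finite type over `𝔽_p` holds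
outright (its local ring is the function field). [folklore] -/
theorem downstairs_genericPoint {p : ℕ} {Y : Scheme.{0}} [IsIntegral Y]
    (f : Y ⟶ Spec (.of (ZMod p))) [LocallyOfFiniteType f] [Fact p.Prime] :
    ∃ U : Y.Opens, genericPoint Y ∈ U ∧ Scheme.HasResolution (U : Scheme.{0}) :=
  downstairs_of_isRegularLocalRing f _ (by
    change IsRegularLocalRing Y.functionField
    infer_instance)

/-- **Shape of a minimal counterexample** (modulo the vendored fact `CossartPiltant2019`): a
prime `p`, an integral separated finite-type `𝔽_p`-scheme `Y` of dimension `≥ 4` (`¬ dim ≤ 3`),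
`s ≥ 1`, an open `W ↪ 𝔸ˢ_Y` and `w ∈ W` with a resolvable open neighbourhood, whose image `y`
is NOT the generic point (its closure is not everything), is a SINGULAR point of `Y`, and has no
resolvable open neighbourhood — a failure of local resolution in characteristic `p`.
[cite: CossartPiltant2019, Thm. 1.1] -/
theorem not_productDescent_minimalCase (hCP : CossartPiltant2019.{0}) (h : ¬ ProductDescent) :
    ∃ p : ℕ, p.Prime ∧ ∃ (Y : Scheme.{0}) (f : Y ⟶ Spec (.of (ZMod p))),
      IsSeparated f ∧ LocallyOfFiniteType f ∧ QuasiCompact f ∧ IsIntegral Y ∧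
      ¬ topologicalKrullDim Y ≤ 3 ∧
      ∃ (s : ℕ) (W : Scheme.{0}) (j : W ⟶ AffineSpace (Fin s) Y), IsOpenImmersion j ∧ 0 < s ∧
      ∃ w : W, (∃ W' : W.Opens, w ∈ W' ∧ Scheme.HasResolution (W' : Scheme.{0})) ∧
        closure {(CategoryTheory.over (AffineSpace (Fin s) Y) Y).base (j.base w)} ≠
          (Set.univ : Set Y) ∧
        ¬ IsRegularLocalRing (Y.presheaf.stalk
            ((CategoryTheory.over (AffineSpace (Fin s) Y) Y).base (j.base w))) ∧
        ∀ U : Y.Opens, (CategoryTheory.over (AffineSpace (Fin s) Y) Y).base (j.base w) ∈ U →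
          ¬ Scheme.HasResolution (U : Scheme.{0}) := by
  obtain ⟨p, hp, Y, f, hs, hl, hq, hi, s, W, j, hj, w, hw, hU⟩ := not_productDescent_iff.mp h
  haveI : Fact p.Prime := ⟨hp⟩
  haveI := hs; haveI := hl; haveI := hq; haveI := hi; haveI := hj
  refine ⟨p, hp, Y, f, hs, hl, hq, hi, fun hdim => ?_, s, W, j, hj, ?_, w, hw, fun hη => ?_,
    fun hreg => ?_, hU⟩
  · exact hU ⊤ trivial ((hasResolution_of_dim_le_three hCP (p := p) (ZMod p) Y f hdim).restrict ⊤)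
  · rcases Nat.eq_zero_or_pos s with hs0 | hs0
    · subst hs0
      obtain ⟨U, hyU, hres⟩ := downstairs_of_fin_zero Y W j w hw
      exact absurd hres (hU U hyU)
    · exact hs0
  · have hgen : IsGenericPoint ((CategoryTheory.over (AffineSpace (Fin s) Y) Y).base (j.base w))
        (⊤ : Set Y) := hη
    obtain ⟨U, hyU, hres⟩ := downstairs_genericPoint (p := p) f (Y := Y)
    exact hU U (hgen.eq (genericPoint_spec Y) ▸ hyU) hres
  · obtain ⟨U, hyU, hres⟩ := downstairs_of_isRegularLocalRing f _ hreg
    exact hU U hyU hres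

end Summit.ResolutionOfSingularities.ResolutionOfSingularities.Theorems.ProductDescent.Negative

end
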